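import Literature.NumberTheory.ComplexMultiplication.EllipticUnits.ImaginaryQuadraticMainConjectureCarriersCores
import Literature.NumberTheory.ComplexMultiplication.EllipticUnits.KatoLayerArtinExponents
import HarnessLib

/-!
# Bookkeeping for corestrictions along an antitone tower of open subgroups: norm-compatible families of
# degree-one classes have target-independent corestrictions (the `s`-independence of the zeta family)

Cell `bsd-print-cf2` (HOME `run/shared/lean/pub/bsd-print-cf2/`), width seat `bsd-line-cf2-p1-w2` g17, piece
«relCores tower-independence» (planner g20 FINAL 15:21:26Z allocation; step 4 of `bsd-line-cf2-p1-w5` g9's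
F0B-ASSEMBLY-PLAN: "`y a n k := relCores_{pairLayer n ← U_{s(n,k)}} (c a s(n,k) k)`; independence of `s` by
transitivity + (norm); (P1) `layerCores y_{n+1,k} = y_{n,k}` (transitivity); (P2) via `relCores_levelRed_succ` +
(red)"); `--supports` stmt-BirchSwinnertonDyer-24721 (helper). THEOREMS ONLY, Theses-free; generic over
`K, p, S, θ` and ANY antitone tower `U : ℕ → Subgroup Γ_K` of open subgroups (e.g. Kato's
`U s = katoLevelSubgroup p 𝔣 s = Gal(K̄/K(p^s𝔣))`) and ANY total family of degree-one classes
`c s ∈ H¹(G_S(K̄^{U s}), μ_{p^k} ⊗ θ)` that is NORM-COMPATIBLE from some `S₀` on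
(`relCores (c (s+1)) = c s`, `s ≥ S₀`; junk below `S₀` allowed).

WHAT IS PROVED (all from `-w5 g9`'s transitivity `JohnsonLeungKings2011.relCores_relCores_one` and
`relCores_levelRed_succ`): §1 **`relCores_eq_of_norm_compatible`** (`S₀ ≤ s < s′ ⇒ relCores_{U_s ← U_{s′}} (c s′) = c s`);
**`relCores_target_eq_of_norm_compatible`** (for any open `V ⊇ U_s` and `S₀ ≤ s ≤ s′`:
`relCores_{V ← U_{s′}} (c s′) = relCores_{V ← U_s} (c s)` — the corestriction to a fixed target does not depend on the
level it is taken from); `relCores_target_relCores` (pushing on to `W ⊇ V` = corestricting directly: the (P1) shape);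
`levelRed_relCores_target` (reduction commutes: the (P2) shape, from a red-law `levelRed (c′ s) = c s`);
§2 the instance for Kato's tower and the `ℤ_p²`-layers: `isOpen_katoLevelSubgroup`,
**`relCores_pairLayer_eq_of_norm_compatible`** (`V = JohnsonLeungKings2011.pairLayerSubgroup κ₁ κ₂ n`, `U = katoLevelSubgroup p 𝔣`) and
`layerCores_relCores_pairLayer` (`layerCores` of the level-`(n+1)` corestriction is the level-`n` one).
HONEST FRAMING: formal bookkeeping; nothing about an elliptic curve; BSD is not advanced.

## References
* [JohnsonLeungKings2011] J. Johnson-Leung, G. Kings, J. reine angew. Math. 653 (2011), Def. 3.5 and §5.2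
  (arXiv:0804.2828 p0010:L55–80, p0014:L60–112: "`_𝔞ζ(χ) := lim←_n _𝔞ζ_{K_n}(χ)`", transitivity of `tr`).
* [Kato2004Asterisque] K. Kato, Astérisque 295 (2004), §15.5 (p. 253: the norm compatible system `(_𝔞z_{pⁿ𝔣})_n`).
-/

set_option linter.dupNamespace false -- `Summit.BirchSwinnertonDyer.BirchSwinnertonDyer` (summit = problem) is the tree's layout
set_option autoImplicit false

noncomputable section

open scoped Classical NumberField
open Field NumberField IsDedekindDomain
open Literature.NumberTheory.GaloisRepresentations
open Literature.NumberTheory.EllipticCurves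
open Literature.NumberTheory.ComplexMultiplication.EllipticUnits
open Literature.NumberTheory.ComplexMultiplication.EllipticUnits.JohnsonLeungKings2011

namespace Summit.BirchSwinnertonDyer.BirchSwinnertonDyer.Theorems.PrintCf2.RelCoresTower

variable {K : Type} [Field K] [NumberField K] (p : ℕ) [Fact p.Prime]
  (S : Set (HeightOneSpectrum (𝓞 K))) (θ : absoluteGaloisGroup K →ₜ* ℤ_[p]ˣ)
  {U : ℕ → Subgroup (absoluteGaloisGroup K)} (hUo : ∀ s, IsOpen (U s : Set (absoluteGaloisGroup K)))
  (hUa : Antitone U)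

/-! ## §1. Norm-compatible families along an antitone tower of open subgroups -/

/-- **Iterated norm-compatibility**: if `relCores_{U_s ← U_{s+1}} (c (s+1)) = c s` for all `s ≥ S₀`, then
`relCores_{U_s ← U_{s′}} (c s′) = c s` for all `S₀ ≤ s < s′` (transitivity of corestriction).
[cite: JohnsonLeungKings2011, Def. 3.5 (arXiv p0010:L70–80, transitivity of `tr`)] -/
theorem relCores_eq_of_norm_compatible {k : ℕ} (c : ∀ s : ℕ, levelCoh p S θ (U s) k 1) {S₀ : ℕ}
    (hc : ∀ s : ℕ, S₀ ≤ s →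
      relCores p S θ (hUa (Nat.le_succ s)) (hUo s) (hUo (s + 1)) k 1 (c (s + 1)) = c s)
    {s s' : ℕ} (hs : S₀ ≤ s) (hss' : s < s') :
    relCores p S θ (hUa hss'.le) (hUo s) (hUo s') k 1 (c s') = c s := by
  induction s' with
  | zero => exact absurd hss' (Nat.not_lt_zero s)
  | succ t ih =>
    rcases (Nat.lt_succ_iff.mp hss').eq_or_lt with rfl | hlt
    · exact hc s hs
    · rw [← relCores_relCores_one p S θ (hUa (Nat.le_succ t)) (hUa hlt.le) (hUo s) (hUo t) (hUo (t + 1)) k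
        (c (t + 1)), hc t (by omega)]
      exact ih hlt

/-- **TARGET-INDEPENDENCE**: for an open `V ⊇ U_s` and `S₀ ≤ s ≤ s′`, the corestriction of `c s′` from `U_{s′}`
to `V` equals that of `c s` from `U_s` — the zeta family's component at a layer does not depend on the auxiliary
level it is read from. [cite: JohnsonLeungKings2011, Def. 3.5 and §5.2 (arXiv p0010:L70–80, p0014:L60–70)] -/
theorem relCores_target_eq_of_norm_compatible {k : ℕ} (c : ∀ s : ℕ, levelCoh p S θ (U s) k 1) {S₀ : ℕ}
    (hc : ∀ s : ℕ, S₀ ≤ s →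
      relCores p S θ (hUa (Nat.le_succ s)) (hUo s) (hUo (s + 1)) k 1 (c (s + 1)) = c s)
    {V : Subgroup (absoluteGaloisGroup K)} (hV : IsOpen (V : Set (absoluteGaloisGroup K)))
    {s s' : ℕ} (hs : S₀ ≤ s) (hss' : s ≤ s') (hsV : U s ≤ V) :
    relCores p S θ ((hUa hss').trans hsV) hV (hUo s') k 1 (c s') =
      relCores p S θ hsV hV (hUo s) k 1 (c s) := by
  rcases hss'.eq_or_lt with rfl | hlt
  · rfl
  · rw [← relCores_eq_of_norm_compatible p S θ hUo hUa c hc hs hlt,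
      relCores_relCores_one p S θ (hUa hlt.le) hsV hV (hUo s) (hUo s') k (c s')]

omit hUa in
/-- **Pushing on to a larger open target is corestricting directly** (`W ⊇ V ⊇ U_s`): the (P1) shape
`layerCores (y_{n+1}) = y_n`. [cite: JohnsonLeungKings2011, Def. 4.2 (94) (arXiv p0012:L94)] -/
theorem relCores_target_relCores {k : ℕ} {V W : Subgroup (absoluteGaloisGroup K)}
    (hV : IsOpen (V : Set (absoluteGaloisGroup K))) (hW : IsOpen (W : Set (absoluteGaloisGroup K)))
    (hVW : V ≤ W) {s : ℕ} (hsV : U s ≤ V) (x : levelCoh p S θ (U s) k 1) :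
    relCores p S θ hVW hW hV k 1 (relCores p S θ hsV hV (hUo s) k 1 x) =
      relCores p S θ (hsV.trans hVW) hW (hUo s) k 1 x :=
  relCores_relCores_one p S θ hsV hVW hW hV (hUo s) k x

omit hUa in
/-- **Reduction commutes with corestriction to the target** (the (P2) shape): from a red-law
`levelRed (c′ s) = c s` at level `U_s`, `levelRed (relCores_{V ← U_s} (c′ s)) = relCores_{V ← U_s} (c s)`.
[cite: Kato2004Asterisque, §8.2 (p. 180)] [cite: JohnsonLeungKings2011, Def. 4.2 (94) (arXiv p0012:L94)] -/
theorem levelRed_relCores_target {k : ℕ} {V : Subgroup (absoluteGaloisGroup K)}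
    (hV : IsOpen (V : Set (absoluteGaloisGroup K))) {s : ℕ} (hsV : U s ≤ V)
    (c' : levelCoh p S θ (U s) (k + 1) 1) (c : levelCoh p S θ (U s) k 1)
    (hred : levelRed p S θ (U s) k 1 c' = c) :
    levelRed p S θ V k 1 (relCores p S θ hsV hV (hUo s) (k + 1) 1 c') =
      relCores p S θ hsV hV (hUo s) k 1 c := by
  rw [← hred, relCores_levelRed_succ]

/-! ## §2. Kato's tower and the `ℤ_p²`-layers -/

variable (𝔣 : Ideal (𝓞 K)) (κ₁ κ₂ : ZpExtension K p)

omit [Fact p.Prime] in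
/-- The level groups `Gal(K̄/K(p^s𝔣))` are open. [cite: Kato2004Asterisque, §15.1 (p. 250)] -/
theorem isOpen_katoLevelSubgroup (s : ℕ) :
    IsOpen (katoLevelSubgroup p 𝔣 s : Set (absoluteGaloisGroup K)) := by
  have h : IsOpen ((absRestrictNormalHom (katoLayer p 𝔣 s)).ker : Set (absoluteGaloisGroup K)) :=
    isOpen_ker_absRestrictNormalHom (katoLayer p 𝔣 s)
  exact h

/-- **THE ZETA FAMILY'S LAYER COMPONENT IS WELL DEFINED**: along Kato's tower `U_s = Gal(K̄/K(p^s𝔣))` (`𝔣 ≠ 0`),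
a family `c s` norm-compatible from `S₀` on has `relCores_{Gal(K̄/K̃_n) ← U_{s′}} (c s′) =
relCores_{Gal(K̄/K̃_n) ← U_s} (c s)` whenever `S₀ ≤ s ≤ s′` and `K̃_n ⊆ K(p^s𝔣)`.
[cite: JohnsonLeungKings2011, Def. 3.5 and §5.2 (arXiv p0010:L70–80, p0014:L60–70)] [cite: Kato2004Asterisque, §15.5 (p. 253)] -/
theorem relCores_pairLayer_eq_of_norm_compatible (h𝔣 : 𝔣 ≠ ⊥) {k : ℕ}
    (c : ∀ s : ℕ, levelCoh p (suppPF p 𝔣) θ (katoLevelSubgroup p 𝔣 s) k 1) {S₀ : ℕ}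
    (hc : ∀ s : ℕ, S₀ ≤ s →
      relCores p (suppPF p 𝔣) θ (katoLevelSubgroup_antitone p 𝔣 h𝔣 (Nat.le_succ s))
        (isOpen_katoLevelSubgroup p 𝔣 s) (isOpen_katoLevelSubgroup p 𝔣 (s + 1)) k 1 (c (s + 1)) = c s)
    (n : ℕ) {s s' : ℕ} (hs : S₀ ≤ s) (hss' : s ≤ s')
    (hsn : katoLevelSubgroup p 𝔣 s ≤ JohnsonLeungKings2011.pairLayerSubgroup κ₁ κ₂ n) :
    relCores p (suppPF p 𝔣) θ ((katoLevelSubgroup_antitone p 𝔣 h𝔣 hss').trans hsn)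
        (JohnsonLeungKings2011.isOpen_pairLayerSubgroup κ₁ κ₂ n) (isOpen_katoLevelSubgroup p 𝔣 s') k 1 (c s') =
      relCores p (suppPF p 𝔣) θ hsn (JohnsonLeungKings2011.isOpen_pairLayerSubgroup κ₁ κ₂ n)
        (isOpen_katoLevelSubgroup p 𝔣 s) k 1 (c s) :=
  relCores_target_eq_of_norm_compatible p (suppPF p 𝔣) θ (isOpen_katoLevelSubgroup p 𝔣)
    (katoLevelSubgroup_antitone p 𝔣 h𝔣) c hc (JohnsonLeungKings2011.isOpen_pairLayerSubgroup κ₁ κ₂ n) hs hss' hsn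

/-- **(P1) for such components**: `layerCores` of the level-`(n+1)` corestriction of `c s` is its level-`n`
corestriction (`K̃_{n+1} ⊆ K(p^s𝔣)`). [cite: JohnsonLeungKings2011, Def. 4.2 (94) (arXiv p0012:L94)] -/
theorem layerCores_relCores_pairLayer {k : ℕ} {s : ℕ} (n : ℕ)
    (hsn : katoLevelSubgroup p 𝔣 s ≤ JohnsonLeungKings2011.pairLayerSubgroup κ₁ κ₂ (n + 1))
    (x : levelCoh p (suppPF p 𝔣) θ (katoLevelSubgroup p 𝔣 s) k 1) :
    layerCores p κ₁ κ₂ θ 𝔣 n k 1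
        (relCores p (suppPF p 𝔣) θ hsn (JohnsonLeungKings2011.isOpen_pairLayerSubgroup κ₁ κ₂ (n + 1))
          (isOpen_katoLevelSubgroup p 𝔣 s) k 1 x) =
      relCores p (suppPF p 𝔣) θ (hsn.trans (JohnsonLeungKings2011.pairLayerSubgroup_antitone κ₁ κ₂ (Nat.le_succ n)))
        (JohnsonLeungKings2011.isOpen_pairLayerSubgroup κ₁ κ₂ n) (isOpen_katoLevelSubgroup p 𝔣 s) k 1 x :=
  relCores_relCores_one p (suppPF p 𝔣) θ hsn (JohnsonLeungKings2011.pairLayerSubgroup_antitone κ₁ κ₂ (Nat.le_succ n))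
    (JohnsonLeungKings2011.isOpen_pairLayerSubgroup κ₁ κ₂ n) (JohnsonLeungKings2011.isOpen_pairLayerSubgroup κ₁ κ₂ (n + 1))
    (isOpen_katoLevelSubgroup p 𝔣 s) k x

/-- **(P2) for such components**: from a red-law at Kato's level, `layerRed` of the corestriction of `c′` is the
corestriction of `c`. [cite: JohnsonLeungKings2011, Def. 4.2 (94) (arXiv p0012:L94)] [cite: Kato2004Asterisque, §8.2 (p. 180)] -/
theorem layerRed_relCores_pairLayer {k : ℕ} {s : ℕ} (n : ℕ)
    (hsn : katoLevelSubgroup p 𝔣 s ≤ JohnsonLeungKings2011.pairLayerSubgroup κ₁ κ₂ n)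
    (c' : levelCoh p (suppPF p 𝔣) θ (katoLevelSubgroup p 𝔣 s) (k + 1) 1)
    (c : levelCoh p (suppPF p 𝔣) θ (katoLevelSubgroup p 𝔣 s) k 1)
    (hred : levelRed p (suppPF p 𝔣) θ (katoLevelSubgroup p 𝔣 s) k 1 c' = c) :
    layerRed p κ₁ κ₂ θ 𝔣 n k 1
        (relCores p (suppPF p 𝔣) θ hsn (JohnsonLeungKings2011.isOpen_pairLayerSubgroup κ₁ κ₂ n)
          (isOpen_katoLevelSubgroup p 𝔣 s) (k + 1) 1 c') =
      relCores p (suppPF p 𝔣) θ hsn (JohnsonLeungKings2011.isOpen_pairLayerSubgroup κ₁ κ₂ n)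
        (isOpen_katoLevelSubgroup p 𝔣 s) k 1 c :=
  levelRed_relCores_target p (suppPF p 𝔣) θ (isOpen_katoLevelSubgroup p 𝔣) (JohnsonLeungKings2011.isOpen_pairLayerSubgroup κ₁ κ₂ n)
    hsn c' c hred

end Summit.BirchSwinnertonDyer.BirchSwinnertonDyer.Theorems.PrintCf2.RelCoresTower
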